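import Summits.QuantumFields.YangMills.Theorems.BalabanUVNodesN09CentralWindowAtRecord
import Summits.QuantumFields.YangMills.Theorems.BalabanUVNodesN07AveragingLocalContinuity
import Literature.MathematicalPhysics.QuantumFieldTheory.Balaban1983to89.BlockAveragingExpMeanLogContinuous
import Literature.MathematicalPhysics.QuantumFieldTheory.Balaban1983to89.B12ContinuousTransportInvarianceOn
import Literature.Topology.ParametricInverseCompactFibre

/-!
# NODE N09 [B12] — THE PRIVATE-COORDINATE INVERSE IS JOINTLY CONTINUOUS IN THE ENVIRONMENT (closed graph + compact fibre, no derivatives)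

Cell `pub-ymgap` (YM-PLAN Track A), width seat `pub-ymgap-dag-n09-w6` g4; helper of K1⁹ `StabilityBRunRowsAtRecordR13SepCoPHV` = stmt-QuantumFields-27364
(`--supports`, `--as helper`, count-neutral).  [I] = [Balaban1987RG1].  CONSUMED BY NAME (nothing modified): this seat's g3 `…N09CentralWindowAtRecord`
(`mem_injWindow_of_mem_centralWindow`, `measurableSet_centralWindow`, ★★★ `exists_perBondCharts_of_forwardLaws`), dag-n07 `…N07AveragingLocalContinuity.continuousAt_avgFun_apply_of_small`
(the (0.4) average `U ↦ Ū(c)` is continuous at every configuration inside the guard at `c`), pub-balaban's `BlockAveraging.continuous_holAt`,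
`B12ContinuousTransportInvarianceOn.continuous_dist1_SU`, `BlockAveragingEMLHaarAC.fibreFamily`, `Node00.avOfRecord_avg` (`rfl`), and this seat's g4 Literature lemma
`Literature.Topology.ParametricInverse.continuousOn_parametricInverse` (parametrised inverses on compact fibres are jointly continuous — Bourbaki GT I §10 no. 2 Thm 1 Cor. 5
with §10 Exerc. 14).

WHERE THIS SITS.  The private-coordinate road («road A′», `HANDOFF-dag-n09-w6.md` §g3) re-shapes N09's analytic inclusion `hreg` into per-bond inversion data `(T, ϑ, jd)` of the
one-variable (0.4) averages `g ↦ Ū(U[β(c) ↦ g])(c)` at the central `α`-windows `Ωα c U = {g | ∀ i, dist1 (fibreFamily U c (pre U c·g·post U c) i) ≤ α}` plus continuity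
sockets; dag-n09-w5 g4's tower `…N09TowerOfPerBondCharts.hreg_pos_all_of_perBondCharts_centralWindow` leaves EXACTLY four of them displayed, `hΦV hJV hΦc hJpos` — «the one-bond
inverse as a function of the environment».  The inverses `ϑ_c(U, ·)` of `exists_perBondCharts_of_forwardLaws` come from Lusin–Souslin and are merely MEASURABLE.  This file proves,
with NO derivative, NO Jacobian, NO law and NO formula for `ϑ`: ANY left inverse `ϑ_c` on the windows is JOINTLY CONTINUOUS in `(U, v)` on the image graph
`{(U, v) | v ∈ Ū′(c)(Ωα c U)}` — because the window graph is closed, the fibre `SU(N)` is compact and the one-variable average is jointly continuous on the window graph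
(`α < δ_N`).  This is the `ϑ`-half of `hΦV` (continuity in the coarse variable at a fixed environment) and of `hΦc` (continuity in the environment at a fixed coarse value) at
interior points of the image graph; the `jd`-half (`hJV`, `hJpos`) is the Jacobian's continuity (dag-n09-w4 g5's INTENT-6 currency) and the boundary ∕ threshold events are
dag-n09-w3's nullities — neither is touched here.

CONTENT (theorems only; 0 `def`, 0 `instance`, 0 `notation`, 0 `sorry`).  §1 generic torus `P`, level `j`, bond `c`: `continuous_centralWindowFamily` · ★ `isClosed_centralWindowGraph` ·
`isClosed_centralWindow` · `isCompact_centralWindow` · ★ `continuousOn_avgFun_update_centralBond_centralWindowGraph` · ★★★ `continuousOn_inverse_centralWindowGraph` ·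
`isClosed_imageCentralWindowGraph` · `isCompact_image_centralWindow` · `continuousOn_inverse_centralWindow_env` · `continuousOn_inverse_centralWindow_fibre` ·
`inverse_mem_centralWindow`; §2 at the record (`F : T4Family`, `j < K`, `avOfRecord`): ★ `continuousOn_inverse_of_leftInverse_record` · `continuousOn_inverse_env_of_leftInverse_record` ·
`isClosed_imageWindowGraph_record` · `isCompact_imageWindow_record`.

HONEST FRAMING.  Count-neutral classical topology BY NAME on the tree's typed (0.4) objects; NO Jacobian law, NO support clause, NO nullity; nothing of Bałaban's estimates asserted;
dag-n09-w5's four sockets are NOT discharged by this alone (interior∕boundary bookkeeping and the `jd`-half remain); `hreg` NOT discharged; N09 NOT discharged; conjunct 1 (Lemma 4) ∕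
FLAG №7 untouched; K0⁷ ∕ K1⁹ ∕ K3⁸ NOT closed; counts unmoved (typed 28∕28 · discharged 5∕28); no summit statement is proved by this seat; one finite four-torus programme at fixed
`ε` — R4 closes the conditional rung `BalabanLadder.UV` only; NOT continuum ∕ ℝ⁴ ∕ OS; the Yang–Mills mass gap (Clay) is NOT proved by any of this.
-/

noncomputable section

namespace Summit.QuantumFields.YangMills.BalabanUVNodes.N09CentralWindowInverseContinuous

open MeasureTheory Set Function Filter Topology
open scoped ENNReal NNReal
open Literature.MathematicalPhysics.QuantumFieldTheory.Balaban1983to89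
open Literature.MathematicalPhysics.QuantumFieldTheory.Balaban1983to89.T4Continuum (T4Family)
open Literature.MathematicalPhysics.QuantumFieldTheory.Balaban1983to89.BlockAveraging (Small Idx avgFun loopHol continuous_holAt)
open Literature.MathematicalPhysics.QuantumFieldTheory.Balaban1983to89.BlockAveragingHaarAC (centralBond pre post openHol IsCentral centralBond_injective)
open Literature.MathematicalPhysics.QuantumFieldTheory.Balaban1983to89.BlockAveragingEMLHaarAC
  (fibreFamily fibreFamily_of_isCentral fibreFamily_of_not_isCentral)
open Literature.MathematicalPhysics.QuantumFieldTheory.Balaban1983to89.B12ContinuousTransportInvarianceOn (continuous_dist1_SU)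
open Literature.MathematicalPhysics.QuantumFieldTheory.Balaban1983to89.ExpMeanLog (expMeanLogSU deltaSU)
open Literature.MathematicalPhysics.QuantumFieldTheory.Balaban1983to89.Node00
open Literature.Topology.ParametricInverse
  (continuousOn_parametricInverse_of_compactSpace isClosed_parametricImageGraph_of_compactSpace isCompact_parametricImage_of_compactSpace
    isClosed_window parametricInverse_mem_window)
open Summit.QuantumFields.YangMills.BalabanUVNodes.N07AveragingLocalContinuity (continuousAt_avgFun_apply_of_small)
open Summit.QuantumFields.YangMills.BalabanUVNodes.N09CentralWindowAtRecord (mem_injWindow_of_mem_centralWindow)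
open Summit.QuantumFields.YangMills.BalabanUVNodes.N09LiftInvariance29AtRecord (succ_le_range_of_lt)

variable {P : Params} {j : ℕ} {N : ℕ} [NeZero N]

/-! ## §1  Generic torus: the window graph is closed, the one-variable average is jointly continuous on it, hence every left inverse is jointly continuous on the image graph -/

/-- The W-coordinate family `(U, g) ↦ fibreFamily U c (pre U c · g · post U c) i` is JOINTLY continuous in the environment and the private coordinate (finite products
and inverses of bond variables in the topological group `SU(N)`). [cite: Balaban1987RG1, (0.4) p.253 (bookkeeping)] -/
theorem continuous_centralWindowFamily (c : PBond P (j + 1)) (i : Idx P) :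
    Continuous fun p : GaugeField P j (SU N) × SU N => fibreFamily p.1 c (pre p.1 c * p.2 * post p.1 c) i := by
  have hW : Continuous fun p : GaugeField P j (SU N) × SU N => pre p.1 c * p.2 * post p.1 c :=
    (((continuous_holAt _).comp continuous_fst).mul continuous_snd).mul ((continuous_holAt _).comp continuous_fst)
  by_cases hi : IsCentral c i
  · simp only [fibreFamily, if_pos hi]
    exact continuous_const
  · simp only [fibreFamily, if_neg hi]
    exact ((continuous_holAt _).comp continuous_fst).mul hW.inv

/-- ★ **THE CENTRAL `α`-WINDOW GRAPH `{(U, g) | g ∈ Ωα c U}` IS CLOSED** in `SU(N)^{bonds_j} × SU(N)` (a finite conjunction of `≤ α` conditions on continuous letters; upgrade of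
`…N09CentralWindowAtRecord.measurableSet_centralWindow`). [cite: Balaban1987RG1, (0.4) p.253 and (2.9) p.266 (bookkeeping)] -/
theorem isClosed_centralWindowGraph (c : PBond P (j + 1)) (α : ℝ) :
    IsClosed {p : GaugeField P j (SU N) × SU N | ∀ i : Idx P, dist1 (fibreFamily p.1 c (pre p.1 c * p.2 * post p.1 c) i) ≤ α} := by
  have hset : {p : GaugeField P j (SU N) × SU N | ∀ i : Idx P, dist1 (fibreFamily p.1 c (pre p.1 c * p.2 * post p.1 c) i) ≤ α} =
      ⋂ i, {p | dist1 (fibreFamily p.1 c (pre p.1 c * p.2 * post p.1 c) i) ≤ α} := by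
    ext p; simp
  rw [hset]
  exact isClosed_iInter fun i => isClosed_le (continuous_dist1_SU.comp (continuous_centralWindowFamily c i)) continuous_const

/-- Each central `α`-window `Ωα c U` is closed in `SU(N)`. [cite: Balaban1987RG1, (0.4) p.253 (bookkeeping)] -/
theorem isClosed_centralWindow (c : PBond P (j + 1)) (α : ℝ) (U : GaugeField P j (SU N)) :
    IsClosed {g : SU N | ∀ i : Idx P, dist1 (fibreFamily U c (pre U c * g * post U c) i) ≤ α} :=
  isClosed_window (K := fun U : GaugeField P j (SU N) => {g : SU N | ∀ i : Idx P, dist1 (fibreFamily U c (pre U c * g * post U c) i) ≤ α})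
    (isClosed_centralWindowGraph c α) U

/-- Each central `α`-window `Ωα c U` is COMPACT (closed in the compact group `SU(N)`). [cite: Balaban1987RG1, (0.4) p.253 (bookkeeping)] -/
theorem isCompact_centralWindow (c : PBond P (j + 1)) (α : ℝ) (U : GaugeField P j (SU N)) :
    IsCompact {g : SU N | ∀ i : Idx P, dist1 (fibreFamily U c (pre U c * g * post U c) i) ≤ α} :=
  (isClosed_centralWindow c α U).isCompact

/-- ★ **THE ONE-VARIABLE (0.4) AVERAGE `(U, g) ↦ Ū(U[β(c) ↦ g])(c)` IS JOINTLY CONTINUOUS ON THE WINDOW GRAPH** (`α < δ_N`): on the window the configuration `U[β(c) ↦ g]` lies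
inside the (0.4) guard at `c` (`mem_injWindow_of_mem_centralWindow`), where `U′ ↦ Ū′(c)` is continuous (N07 `continuousAt_avgFun_apply_of_small`), and `(U, g) ↦ U[β(c) ↦ g]` is
continuous (Mathlib `continuous_update`). [cite: Balaban1987RG1, (0.4) p.253] -/
theorem continuousOn_avgFun_update_centralBond_centralWindowGraph (hj : j + 1 ≤ P.m + P.K) (c : PBond P (j + 1)) {α : ℝ}
    (hαδ : α < deltaSU (Fin N)) :
    ContinuousOn (fun p : GaugeField P j (SU N) × SU N => avgFun (expMeanLogSU (n := Fin N)) (Function.update p.1 (centralBond c) p.2) c)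
      {p : GaugeField P j (SU N) × SU N | ∀ i : Idx P, dist1 (fibreFamily p.1 c (pre p.1 c * p.2 * post p.1 c) i) ≤ α} := by
  intro p hp
  have hsmall : Small (expMeanLogSU (n := Fin N)) (Function.update p.1 (centralBond c) p.2) c :=
    (mem_injWindow_of_mem_centralWindow hj c hαδ p.1 hp).1
  have hu : ContinuousAt (fun q : GaugeField P j (SU N) × SU N => Function.update q.1 (centralBond c) q.2) p :=
    (continuous_update (centralBond c)).continuousAt
  exact (ContinuousAt.comp_of_eq (continuousAt_avgFun_apply_of_small c hsmall) hu rfl).continuousWithinAt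

/-- ★★★ **EVERY LEFT INVERSE OF THE ONE-VARIABLE AVERAGE ON THE CENTRAL WINDOWS IS JOINTLY CONTINUOUS IN (ENVIRONMENT, COARSE VALUE) ON THE IMAGE GRAPH** (`α < δ_N`).
For ANY `ϑ : SU(N)^{bonds_j} → SU(N) → SU(N)` with `ϑ U (Ū(U[β(c) ↦ g])(c)) = g` for `g ∈ Ωα c U` — in particular the Lusin–Souslin inverse of
`…N09CentralWindowAtRecord.exists_perBondCharts_of_forwardLaws` — the map `(U, v) ↦ ϑ U v` is continuous on `{(U, v) | v ∈ Ū′(c)(Ωα c U)}`.  Closed window graph + compact fibre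
`SU(N)` + Hausdorff values (`Literature.Topology.ParametricInverse.continuousOn_parametricInverse_of_compactSpace`); no derivative, no Jacobian, no law.
[cite: Balaban1987RG1, (0.4) p.253 and (2.10) p.267 («B′(b₀(c)) expressed by the remaining variables»); BourbakiGT1, Ch. I §10 no. 2, Thm 1 Cor. 5] -/
theorem continuousOn_inverse_centralWindowGraph (hj : j + 1 ≤ P.m + P.K) (c : PBond P (j + 1)) {α : ℝ} (hαδ : α < deltaSU (Fin N))
    (ϑ : GaugeField P j (SU N) → SU N → SU N)
    (hleft : ∀ (U : GaugeField P j (SU N)) (g : SU N), (∀ i : Idx P, dist1 (fibreFamily U c (pre U c * g * post U c) i) ≤ α) →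
      ϑ U (avgFun (expMeanLogSU (n := Fin N)) (Function.update U (centralBond c) g) c) = g) :
    ContinuousOn (fun q : GaugeField P j (SU N) × SU N => ϑ q.1 q.2)
      {q : GaugeField P j (SU N) × SU N | q.2 ∈ (fun g : SU N => avgFun (expMeanLogSU (n := Fin N)) (Function.update q.1 (centralBond c) g) c) ''
        {g : SU N | ∀ i : Idx P, dist1 (fibreFamily q.1 c (pre q.1 c * g * post q.1 c) i) ≤ α}} :=
  continuousOn_parametricInverse_of_compactSpace
    (F := fun (U : GaugeField P j (SU N)) (g : SU N) => avgFun (expMeanLogSU (n := Fin N)) (Function.update U (centralBond c) g) c)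
    (K := fun U : GaugeField P j (SU N) => {g : SU N | ∀ i : Idx P, dist1 (fibreFamily U c (pre U c * g * post U c) i) ≤ α}) (ϑ := ϑ)
    (isClosed_centralWindowGraph c α) (continuousOn_avgFun_update_centralBond_centralWindowGraph hj c hαδ) fun U g hg => hleft U g hg

/-- **THE IMAGE GRAPH `{(U, v) | v ∈ Ū′(c)(Ωα c U)}` IS CLOSED** (`α < δ_N`); in particular it is (jointly) measurable for every Borel structure — the `hTm` clause of the road again,
by topology. [cite: Balaban1987RG1, (0.4) p.253 and (2.10) p.267 (bookkeeping); BourbakiGT1, Ch. I §10 no. 2, Thm 1 Cor. 5] -/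
theorem isClosed_imageCentralWindowGraph (hj : j + 1 ≤ P.m + P.K) (c : PBond P (j + 1)) {α : ℝ} (hαδ : α < deltaSU (Fin N)) :
    IsClosed {q : GaugeField P j (SU N) × SU N | q.2 ∈ (fun g : SU N => avgFun (expMeanLogSU (n := Fin N)) (Function.update q.1 (centralBond c) g) c) ''
        {g : SU N | ∀ i : Idx P, dist1 (fibreFamily q.1 c (pre q.1 c * g * post q.1 c) i) ≤ α}} :=
  isClosed_parametricImageGraph_of_compactSpace
    (F := fun (U : GaugeField P j (SU N)) (g : SU N) => avgFun (expMeanLogSU (n := Fin N)) (Function.update U (centralBond c) g) c)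
    (K := fun U : GaugeField P j (SU N) => {g : SU N | ∀ i : Idx P, dist1 (fibreFamily U c (pre U c * g * post U c) i) ≤ α})
    (isClosed_centralWindowGraph c α) (continuousOn_avgFun_update_centralBond_centralWindowGraph hj c hαδ)

/-- **EACH IMAGE WINDOW `T_c(U) = Ū′(c)(Ωα c U)` IS COMPACT** (`α < δ_N`). [cite: Balaban1987RG1, (0.4) p.253 and (2.10) p.267 (bookkeeping)] -/
theorem isCompact_image_centralWindow (hj : j + 1 ≤ P.m + P.K) (c : PBond P (j + 1)) {α : ℝ} (hαδ : α < deltaSU (Fin N)) (U : GaugeField P j (SU N)) :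
    IsCompact ((fun g : SU N => avgFun (expMeanLogSU (n := Fin N)) (Function.update U (centralBond c) g) c) ''
      {g : SU N | ∀ i : Idx P, dist1 (fibreFamily U c (pre U c * g * post U c) i) ≤ α}) :=
  isCompact_parametricImage_of_compactSpace
    (F := fun (U : GaugeField P j (SU N)) (g : SU N) => avgFun (expMeanLogSU (n := Fin N)) (Function.update U (centralBond c) g) c)
    (K := fun U : GaugeField P j (SU N) => {g : SU N | ∀ i : Idx P, dist1 (fibreFamily U c (pre U c * g * post U c) i) ≤ α})
    (isClosed_centralWindowGraph c α) (continuousOn_avgFun_update_centralBond_centralWindowGraph hj c hαδ) U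

/-- **CONTINUITY IN THE ENVIRONMENT at a fixed coarse value `v`** (`α < δ_N`): `U ↦ ϑ U v` is continuous on `{U | v ∈ Ū′(c)(Ωα c U)}` — the `hΦc`-direction of dag-n09-w5's sockets
at interior points. [cite: Balaban1987RG1, (0.4) p.253 and (2.10) p.267; BourbakiGT1, Ch. I §10 no. 2, Thm 1 Cor. 5] -/
theorem continuousOn_inverse_centralWindow_env (hj : j + 1 ≤ P.m + P.K) (c : PBond P (j + 1)) {α : ℝ} (hαδ : α < deltaSU (Fin N))
    (ϑ : GaugeField P j (SU N) → SU N → SU N)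
    (hleft : ∀ (U : GaugeField P j (SU N)) (g : SU N), (∀ i : Idx P, dist1 (fibreFamily U c (pre U c * g * post U c) i) ≤ α) →
      ϑ U (avgFun (expMeanLogSU (n := Fin N)) (Function.update U (centralBond c) g) c) = g) (v : SU N) :
    ContinuousOn (fun U : GaugeField P j (SU N) => ϑ U v)
      {U : GaugeField P j (SU N) | v ∈ (fun g : SU N => avgFun (expMeanLogSU (n := Fin N)) (Function.update U (centralBond c) g) c) ''
        {g : SU N | ∀ i : Idx P, dist1 (fibreFamily U c (pre U c * g * post U c) i) ≤ α}} :=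
  (continuousOn_inverse_centralWindowGraph hj c hαδ ϑ hleft).comp (continuous_id.prodMk continuous_const).continuousOn fun _ hU => hU

/-- **CONTINUITY IN THE COARSE VALUE at a fixed environment `U`** (`α < δ_N`): `ϑ U` is continuous on the image window `T_c(U)` — the `hΦV`-direction of dag-n09-w5's sockets at interior
points («`ϑ_c(U, ·)` is continuous for free on the compact window», `HANDOFF-dag-n09-w6.md` §g3 (C)). [cite: Balaban1987RG1, (0.4) p.253 and (2.10) p.267; BourbakiGT1, Ch. I §9 no. 4, Thm 2 Cor. 2] -/
theorem continuousOn_inverse_centralWindow_fibre (hj : j + 1 ≤ P.m + P.K) (c : PBond P (j + 1)) {α : ℝ} (hαδ : α < deltaSU (Fin N))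
    (ϑ : GaugeField P j (SU N) → SU N → SU N)
    (hleft : ∀ (U : GaugeField P j (SU N)) (g : SU N), (∀ i : Idx P, dist1 (fibreFamily U c (pre U c * g * post U c) i) ≤ α) →
      ϑ U (avgFun (expMeanLogSU (n := Fin N)) (Function.update U (centralBond c) g) c) = g) (U : GaugeField P j (SU N)) :
    ContinuousOn (ϑ U) ((fun g : SU N => avgFun (expMeanLogSU (n := Fin N)) (Function.update U (centralBond c) g) c) ''
        {g : SU N | ∀ i : Idx P, dist1 (fibreFamily U c (pre U c * g * post U c) i) ≤ α}) :=
  (continuousOn_inverse_centralWindowGraph hj c hαδ ϑ hleft).comp (continuous_const.prodMk continuous_id).continuousOn fun _ hv => hv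

/-- **JOINT `ContinuousAt` AT INTERIOR POINTS of the image graph** (`α < δ_N`). [cite: Balaban1987RG1, (0.4) p.253 and (2.10) p.267; BourbakiGT1, Ch. I §10 no. 2, Thm 1 Cor. 5] -/
theorem continuousAt_inverse_of_mem_interior_imageCentralWindowGraph (hj : j + 1 ≤ P.m + P.K) (c : PBond P (j + 1)) {α : ℝ} (hαδ : α < deltaSU (Fin N))
    (ϑ : GaugeField P j (SU N) → SU N → SU N)
    (hleft : ∀ (U : GaugeField P j (SU N)) (g : SU N), (∀ i : Idx P, dist1 (fibreFamily U c (pre U c * g * post U c) i) ≤ α) →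
      ϑ U (avgFun (expMeanLogSU (n := Fin N)) (Function.update U (centralBond c) g) c) = g) {q : GaugeField P j (SU N) × SU N}
    (hq : q ∈ interior {q : GaugeField P j (SU N) × SU N | q.2 ∈ (fun g : SU N => avgFun (expMeanLogSU (n := Fin N)) (Function.update q.1 (centralBond c) g) c) ''
        {g : SU N | ∀ i : Idx P, dist1 (fibreFamily q.1 c (pre q.1 c * g * post q.1 c) i) ≤ α}}) :
    ContinuousAt (fun q : GaugeField P j (SU N) × SU N => ϑ q.1 q.2) q :=
  (continuousOn_inverse_centralWindowGraph hj c hαδ ϑ hleft).continuousAt (mem_interior_iff_mem_nhds.mp hq)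

/-- On the image window every left inverse takes values IN the window: `ϑ U v ∈ Ωα c U` for `v ∈ T_c(U)` (set bookkeeping). [cite: Balaban1987RG1, (0.4) p.253 and (2.10) p.267 (bookkeeping)] -/
theorem inverse_mem_centralWindow (c : PBond P (j + 1)) {α : ℝ} (ϑ : GaugeField P j (SU N) → SU N → SU N)
    (hleft : ∀ (U : GaugeField P j (SU N)) (g : SU N), (∀ i : Idx P, dist1 (fibreFamily U c (pre U c * g * post U c) i) ≤ α) →
      ϑ U (avgFun (expMeanLogSU (n := Fin N)) (Function.update U (centralBond c) g) c) = g) {U : GaugeField P j (SU N)} {v : SU N}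
    (hv : v ∈ (fun g : SU N => avgFun (expMeanLogSU (n := Fin N)) (Function.update U (centralBond c) g) c) ''
        {g : SU N | ∀ i : Idx P, dist1 (fibreFamily U c (pre U c * g * post U c) i) ≤ α}) :
    ∀ i : Idx P, dist1 (fibreFamily U c (pre U c * ϑ U v * post U c) i) ≤ α :=
  parametricInverse_mem_window
    (F := fun (U : GaugeField P j (SU N)) (g : SU N) => avgFun (expMeanLogSU (n := Fin N)) (Function.update U (centralBond c) g) c)
    (K := fun U : GaugeField P j (SU N) => {g : SU N | ∀ i : Idx P, dist1 (fibreFamily U c (pre U c * g * post U c) i) ≤ α}) (ϑ := ϑ)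
    (fun U g hg => hleft U g hg) hv

/-! ## §2  At the record (`F : T4Family`, torus `K`, level `j < K`, `avOfRecord F N K j = blockAvg expMeanLogSU`) -/

variable {F : T4Family}

/-- ★ **AT THE RECORD: every left inverse `ϑ_c` on the central windows — in particular the `ϑ` of `…N09CentralWindowAtRecord.exists_perBondCharts_of_forwardLaws`, whose left-inverse
clause and image-window clause are exactly `hleft` and `hT` below — is JOINTLY CONTINUOUS in `(U, v)` on the graph `{(U, v) | v ∈ T_c(U)}`**, for every coarse bond `c`, as soon as
`α < δ_N` (`j < K` puts level `j+1` in the standing range). [cite: Balaban1987RG1, (0.4) p.253 and (2.10) p.267; BourbakiGT1, Ch. I §10 no. 2, Thm 1 Cor. 5] -/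
theorem continuousOn_inverse_of_leftInverse_record {K : ℕ} (hj : j < K) {α : ℝ} (hαδ : α < deltaSU (Fin N))
    (T : PBond (F.P K) (j + 1) → GaugeField (F.P K) j (SU N) → Set (SU N))
    (ϑ : PBond (F.P K) (j + 1) → GaugeField (F.P K) j (SU N) → SU N → SU N)
    (hT : ∀ c U, T c U = (fun g => (avOfRecord F N K j).avg (Function.update U (centralBond c) g) c) ''
        {g : SU N | ∀ i : Idx (F.P K), dist1 (fibreFamily U c (pre U c * g * post U c) i) ≤ α})
    (hleft : ∀ c U g, (∀ i : Idx (F.P K), dist1 (fibreFamily U c (pre U c * g * post U c) i) ≤ α) →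
        ϑ c U ((avOfRecord F N K j).avg (Function.update U (centralBond c) g) c) = g) (c : PBond (F.P K) (j + 1)) :
    ContinuousOn (fun q : GaugeField (F.P K) j (SU N) × SU N => ϑ c q.1 q.2) {q : GaugeField (F.P K) j (SU N) × SU N | q.2 ∈ T c q.1} := by
  have hset : {q : GaugeField (F.P K) j (SU N) × SU N | q.2 ∈ T c q.1} =
      {q : GaugeField (F.P K) j (SU N) × SU N | q.2 ∈ (fun g : SU N => avgFun (expMeanLogSU (n := Fin N)) (Function.update q.1 (centralBond c) g) c) ''
        {g : SU N | ∀ i : Idx (F.P K), dist1 (fibreFamily q.1 c (pre q.1 c * g * post q.1 c) i) ≤ α}} := by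
    ext q
    rw [mem_setOf_eq, mem_setOf_eq, hT c q.1, avOfRecord_avg]
  rw [hset]
  exact continuousOn_inverse_centralWindowGraph (succ_le_range_of_lt hj) c hαδ (ϑ c) fun U g hg => by
    have h := hleft c U g hg
    rw [avOfRecord_avg] at h
    exact h

/-- **AT THE RECORD, continuity in the environment at a fixed coarse value**: `U ↦ ϑ_c(U, v)` is continuous on `{U | v ∈ T_c(U)}`.
[cite: Balaban1987RG1, (0.4) p.253 and (2.10) p.267; BourbakiGT1, Ch. I §10 no. 2, Thm 1 Cor. 5] -/
theorem continuousOn_inverse_env_of_leftInverse_record {K : ℕ} (hj : j < K) {α : ℝ} (hαδ : α < deltaSU (Fin N))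
    (T : PBond (F.P K) (j + 1) → GaugeField (F.P K) j (SU N) → Set (SU N))
    (ϑ : PBond (F.P K) (j + 1) → GaugeField (F.P K) j (SU N) → SU N → SU N)
    (hT : ∀ c U, T c U = (fun g => (avOfRecord F N K j).avg (Function.update U (centralBond c) g) c) ''
        {g : SU N | ∀ i : Idx (F.P K), dist1 (fibreFamily U c (pre U c * g * post U c) i) ≤ α})
    (hleft : ∀ c U g, (∀ i : Idx (F.P K), dist1 (fibreFamily U c (pre U c * g * post U c) i) ≤ α) →
        ϑ c U ((avOfRecord F N K j).avg (Function.update U (centralBond c) g) c) = g) (c : PBond (F.P K) (j + 1)) (v : SU N) :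
    ContinuousOn (fun U : GaugeField (F.P K) j (SU N) => ϑ c U v) {U : GaugeField (F.P K) j (SU N) | v ∈ T c U} :=
  (continuousOn_inverse_of_leftInverse_record hj hαδ T ϑ hT hleft c).comp (continuous_id.prodMk continuous_const).continuousOn fun _ hU => hU

/-- **AT THE RECORD, continuity in the coarse value at a fixed environment**: `ϑ_c(U, ·)` is continuous on `T_c(U)`.
[cite: Balaban1987RG1, (0.4) p.253 and (2.10) p.267; BourbakiGT1, Ch. I §9 no. 4, Thm 2 Cor. 2] -/
theorem continuousOn_inverse_fibre_of_leftInverse_record {K : ℕ} (hj : j < K) {α : ℝ} (hαδ : α < deltaSU (Fin N))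
    (T : PBond (F.P K) (j + 1) → GaugeField (F.P K) j (SU N) → Set (SU N))
    (ϑ : PBond (F.P K) (j + 1) → GaugeField (F.P K) j (SU N) → SU N → SU N)
    (hT : ∀ c U, T c U = (fun g => (avOfRecord F N K j).avg (Function.update U (centralBond c) g) c) ''
        {g : SU N | ∀ i : Idx (F.P K), dist1 (fibreFamily U c (pre U c * g * post U c) i) ≤ α})
    (hleft : ∀ c U g, (∀ i : Idx (F.P K), dist1 (fibreFamily U c (pre U c * g * post U c) i) ≤ α) →
        ϑ c U ((avOfRecord F N K j).avg (Function.update U (centralBond c) g) c) = g) (c : PBond (F.P K) (j + 1))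
    (U : GaugeField (F.P K) j (SU N)) : ContinuousOn (ϑ c U) (T c U) :=
  (continuousOn_inverse_of_leftInverse_record hj hαδ T ϑ hT hleft c).comp (continuous_const.prodMk continuous_id).continuousOn fun _ hv => hv

/-- **AT THE RECORD: the `T`-graph `{(U, v) | v ∈ T_c(U)}` is CLOSED** (hence jointly measurable by topology — the `hTm` clause of `hreg_of_perBondCharts` again).
[cite: Balaban1987RG1, (0.4) p.253 and (2.10) p.267 (bookkeeping); BourbakiGT1, Ch. I §10 no. 2, Thm 1 Cor. 5] -/
theorem isClosed_imageWindowGraph_record {K : ℕ} (hj : j < K) {α : ℝ} (hαδ : α < deltaSU (Fin N))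
    (T : PBond (F.P K) (j + 1) → GaugeField (F.P K) j (SU N) → Set (SU N))
    (hT : ∀ c U, T c U = (fun g => (avOfRecord F N K j).avg (Function.update U (centralBond c) g) c) ''
        {g : SU N | ∀ i : Idx (F.P K), dist1 (fibreFamily U c (pre U c * g * post U c) i) ≤ α}) (c : PBond (F.P K) (j + 1)) :
    IsClosed {q : GaugeField (F.P K) j (SU N) × SU N | q.2 ∈ T c q.1} := by
  have hset : {q : GaugeField (F.P K) j (SU N) × SU N | q.2 ∈ T c q.1} =
      {q : GaugeField (F.P K) j (SU N) × SU N | q.2 ∈ (fun g : SU N => avgFun (expMeanLogSU (n := Fin N)) (Function.update q.1 (centralBond c) g) c) ''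
        {g : SU N | ∀ i : Idx (F.P K), dist1 (fibreFamily q.1 c (pre q.1 c * g * post q.1 c) i) ≤ α}} := by
    ext q
    rw [mem_setOf_eq, mem_setOf_eq, hT c q.1, avOfRecord_avg]
  rw [hset]
  exact isClosed_imageCentralWindowGraph (succ_le_range_of_lt hj) c hαδ

/-- **AT THE RECORD: each image window `T_c(U)` is COMPACT.** [cite: Balaban1987RG1, (0.4) p.253 and (2.10) p.267 (bookkeeping)] -/
theorem isCompact_imageWindow_record {K : ℕ} (hj : j < K) {α : ℝ} (hαδ : α < deltaSU (Fin N))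
    (T : PBond (F.P K) (j + 1) → GaugeField (F.P K) j (SU N) → Set (SU N))
    (hT : ∀ c U, T c U = (fun g => (avOfRecord F N K j).avg (Function.update U (centralBond c) g) c) ''
        {g : SU N | ∀ i : Idx (F.P K), dist1 (fibreFamily U c (pre U c * g * post U c) i) ≤ α}) (c : PBond (F.P K) (j + 1))
    (U : GaugeField (F.P K) j (SU N)) : IsCompact (T c U) := by
  rw [hT c U, avOfRecord_avg]
  exact isCompact_image_centralWindow (succ_le_range_of_lt hj) c hαδ U


/-! ## §3  The triangular chart `(V, z) ↦ z[β(c) ↦ ϑ_c(z, V c)]_c` is jointly continuous on the joint image graph -/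

/-- ★★ **THE TRIANGULAR CHART IS JOINTLY CONTINUOUS IN (COARSE FIELD, ENVIRONMENT) ON THE JOINT IMAGE GRAPH** (`α < δ_N`): for any per-bond family of left inverses `ϑ_c` on the
central windows, `(V, z) ↦ extend β (c ↦ ϑ_c(z, V c)) z` — road A′'s chart `Φ_tri` (`T4TriangularFibredChart`, dag-n09-w5's `…N09TowerChartOfPerBondCharts`) — is continuous on
`{(V, z) | ∀ c, V c ∈ Ū′(c)(Ωα c z)}` (coordinatewise: the central coordinates are the jointly continuous inverses of §1, the private ones are untouched).
[cite: Balaban1987RG1, (2.10) p.267 («B′(b₀(c)) expressed by the remaining variables»); BourbakiGT1, Ch. I §10 no. 2, Thm 1 Cor. 5] -/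
theorem continuousOn_triChart_imageGraph (hj : j + 1 ≤ P.m + P.K) {α : ℝ} (hαδ : α < deltaSU (Fin N))
    (ϑ : PBond P (j + 1) → GaugeField P j (SU N) → SU N → SU N)
    (hleft : ∀ (c : PBond P (j + 1)) (U : GaugeField P j (SU N)) (g : SU N), (∀ i : Idx P, dist1 (fibreFamily U c (pre U c * g * post U c) i) ≤ α) →
      ϑ c U (avgFun (expMeanLogSU (n := Fin N)) (Function.update U (centralBond c) g) c) = g) :
    ContinuousOn (fun p : (PBond P (j + 1) → SU N) × GaugeField P j (SU N) => (extend centralBond (fun c => ϑ c p.2 (p.1 c)) p.2 : GaugeField P j (SU N)))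
      {p : (PBond P (j + 1) → SU N) × GaugeField P j (SU N) | ∀ c : PBond P (j + 1),
        p.1 c ∈ (fun g : SU N => avgFun (expMeanLogSU (n := Fin N)) (Function.update p.2 (centralBond c) g) c) ''
          {g : SU N | ∀ i : Idx P, dist1 (fibreFamily p.2 c (pre p.2 c * g * post p.2 c) i) ≤ α}} := by
  refine continuousOn_pi.2 fun b => ?_
  by_cases hb : ∃ c, centralBond c = b
  · obtain ⟨c, rfl⟩ := hb
    have h : (fun p : (PBond P (j + 1) → SU N) × GaugeField P j (SU N) =>
        (extend centralBond (fun c => ϑ c p.2 (p.1 c)) p.2 : GaugeField P j (SU N)) (centralBond c)) = fun p => ϑ c p.2 (p.1 c) := by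
      funext p
      exact (centralBond_injective hj).extend_apply _ _ c
    rw [h]
    have hf : Continuous fun p : (PBond P (j + 1) → SU N) × GaugeField P j (SU N) => ((p.2, p.1 c) : GaugeField P j (SU N) × SU N) :=
      continuous_snd.prodMk ((continuous_apply c).comp continuous_fst)
    have hmaps : MapsTo (fun p : (PBond P (j + 1) → SU N) × GaugeField P j (SU N) => ((p.2, p.1 c) : GaugeField P j (SU N) × SU N))
        {p : (PBond P (j + 1) → SU N) × GaugeField P j (SU N) | ∀ c : PBond P (j + 1),
          p.1 c ∈ (fun g : SU N => avgFun (expMeanLogSU (n := Fin N)) (Function.update p.2 (centralBond c) g) c) ''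
            {g : SU N | ∀ i : Idx P, dist1 (fibreFamily p.2 c (pre p.2 c * g * post p.2 c) i) ≤ α}}
        {q : GaugeField P j (SU N) × SU N | q.2 ∈ (fun g : SU N => avgFun (expMeanLogSU (n := Fin N)) (Function.update q.1 (centralBond c) g) c) ''
          {g : SU N | ∀ i : Idx P, dist1 (fibreFamily q.1 c (pre q.1 c * g * post q.1 c) i) ≤ α}} := fun p hp => hp c
    exact (continuousOn_inverse_centralWindowGraph hj c hαδ (ϑ c) (hleft c)).comp hf.continuousOn hmaps
  · have h : (fun p : (PBond P (j + 1) → SU N) × GaugeField P j (SU N) =>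
        (extend centralBond (fun c => ϑ c p.2 (p.1 c)) p.2 : GaugeField P j (SU N)) b) = fun p => p.2 b := by
      funext p
      rw [Function.extend_def, dif_neg hb]
    rw [h]
    exact ((continuous_apply b).comp continuous_snd).continuousOn

/-- **Continuity of the triangular chart IN THE ENVIRONMENT at a fixed coarse field `V`** (`α < δ_N`): `z ↦ extend β (c ↦ ϑ_c(z, V c)) z` is continuous on `{z | ∀ c, V c ∈ T_c(z)}` — the
`hΦc`-direction of dag-n09-w5's sockets at interior points. [cite: Balaban1987RG1, (2.10) p.267; BourbakiGT1, Ch. I §10 no. 2, Thm 1 Cor. 5] -/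
theorem continuousOn_triChart_env (hj : j + 1 ≤ P.m + P.K) {α : ℝ} (hαδ : α < deltaSU (Fin N))
    (ϑ : PBond P (j + 1) → GaugeField P j (SU N) → SU N → SU N)
    (hleft : ∀ (c : PBond P (j + 1)) (U : GaugeField P j (SU N)) (g : SU N), (∀ i : Idx P, dist1 (fibreFamily U c (pre U c * g * post U c) i) ≤ α) →
      ϑ c U (avgFun (expMeanLogSU (n := Fin N)) (Function.update U (centralBond c) g) c) = g) (V : PBond P (j + 1) → SU N) :
    ContinuousOn (fun z : GaugeField P j (SU N) => (extend centralBond (fun c => ϑ c z (V c)) z : GaugeField P j (SU N)))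
      {z : GaugeField P j (SU N) | ∀ c : PBond P (j + 1),
        V c ∈ (fun g : SU N => avgFun (expMeanLogSU (n := Fin N)) (Function.update z (centralBond c) g) c) ''
          {g : SU N | ∀ i : Idx P, dist1 (fibreFamily z c (pre z c * g * post z c) i) ≤ α}} :=
  (continuousOn_triChart_imageGraph hj hαδ ϑ hleft).comp (continuous_const.prodMk continuous_id).continuousOn fun _ hz => hz

/-- **Continuity of the triangular chart IN THE COARSE FIELD at a fixed environment `z`** (`α < δ_N`): `V ↦ extend β (c ↦ ϑ_c(z, V c)) z` is continuous on `{V | ∀ c, V c ∈ T_c(z)}` — the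
`hΦV`-direction of dag-n09-w5's sockets at interior points. [cite: Balaban1987RG1, (2.10) p.267; BourbakiGT1, Ch. I §9 no. 4, Thm 2 Cor. 2] -/
theorem continuousOn_triChart_fibre (hj : j + 1 ≤ P.m + P.K) {α : ℝ} (hαδ : α < deltaSU (Fin N))
    (ϑ : PBond P (j + 1) → GaugeField P j (SU N) → SU N → SU N)
    (hleft : ∀ (c : PBond P (j + 1)) (U : GaugeField P j (SU N)) (g : SU N), (∀ i : Idx P, dist1 (fibreFamily U c (pre U c * g * post U c) i) ≤ α) →
      ϑ c U (avgFun (expMeanLogSU (n := Fin N)) (Function.update U (centralBond c) g) c) = g) (z : GaugeField P j (SU N)) :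
    ContinuousOn (fun V : PBond P (j + 1) → SU N => (extend centralBond (fun c => ϑ c z (V c)) z : GaugeField P j (SU N)))
      {V : PBond P (j + 1) → SU N | ∀ c : PBond P (j + 1),
        V c ∈ (fun g : SU N => avgFun (expMeanLogSU (n := Fin N)) (Function.update z (centralBond c) g) c) ''
          {g : SU N | ∀ i : Idx P, dist1 (fibreFamily z c (pre z c * g * post z c) i) ≤ α}} :=
  (continuousOn_triChart_imageGraph hj hαδ ϑ hleft).comp (continuous_id.prodMk continuous_const).continuousOn fun _ hV => hV

/-- ★ **AT THE RECORD: road A′'s triangular chart `(V, z) ↦ extend β (c ↦ ϑ_c(z, V c)) z` is JOINTLY continuous on `{(V, z) | ∀ c, V c ∈ T_c(z)}`** for the `(T, ϑ)` of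
`exists_perBondCharts_of_forwardLaws` (`j < K`, `α < δ_N`). [cite: Balaban1987RG1, (2.10) p.267; BourbakiGT1, Ch. I §10 no. 2, Thm 1 Cor. 5] -/
theorem continuousOn_triChart_of_leftInverse_record {F : T4Family} {K : ℕ} (hj : j < K) {α : ℝ} (hαδ : α < deltaSU (Fin N))
    (T : PBond (F.P K) (j + 1) → GaugeField (F.P K) j (SU N) → Set (SU N))
    (ϑ : PBond (F.P K) (j + 1) → GaugeField (F.P K) j (SU N) → SU N → SU N)
    (hT : ∀ c U, T c U = (fun g => (avOfRecord F N K j).avg (Function.update U (centralBond c) g) c) ''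
        {g : SU N | ∀ i : Idx (F.P K), dist1 (fibreFamily U c (pre U c * g * post U c) i) ≤ α})
    (hleft : ∀ c U g, (∀ i : Idx (F.P K), dist1 (fibreFamily U c (pre U c * g * post U c) i) ≤ α) →
        ϑ c U ((avOfRecord F N K j).avg (Function.update U (centralBond c) g) c) = g) :
    ContinuousOn (fun p : (PBond (F.P K) (j + 1) → SU N) × GaugeField (F.P K) j (SU N) =>
        (extend centralBond (fun c => ϑ c p.2 (p.1 c)) p.2 : GaugeField (F.P K) j (SU N)))
      {p : (PBond (F.P K) (j + 1) → SU N) × GaugeField (F.P K) j (SU N) | ∀ c, p.1 c ∈ T c p.2} := by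
  have hset : {p : (PBond (F.P K) (j + 1) → SU N) × GaugeField (F.P K) j (SU N) | ∀ c, p.1 c ∈ T c p.2} =
      {p : (PBond (F.P K) (j + 1) → SU N) × GaugeField (F.P K) j (SU N) | ∀ c : PBond (F.P K) (j + 1),
        p.1 c ∈ (fun g : SU N => avgFun (expMeanLogSU (n := Fin N)) (Function.update p.2 (centralBond c) g) c) ''
          {g : SU N | ∀ i : Idx (F.P K), dist1 (fibreFamily p.2 c (pre p.2 c * g * post p.2 c) i) ≤ α}} := by
    ext p
    simp only [mem_setOf_eq]
    refine forall_congr' fun c => ?_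
    rw [hT c p.2, avOfRecord_avg]
  rw [hset]
  exact continuousOn_triChart_imageGraph (succ_le_range_of_lt hj) hαδ ϑ fun c U g hg => by
    have h := hleft c U g hg
    rw [avOfRecord_avg] at h
    exact h

end Summit.QuantumFields.YangMills.BalabanUVNodes.N09CentralWindowInverseContinuous

end
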